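/-
Copyright (c) 2026 the pub-hodgecm-mathlib formalisation cell (harness21).  Prover seat hodgecm-mathlib-LH4-p13 (g0): Track A «(D-RAM) FOUR-FRAME» squad of crux H413
(dealer LH4-plan (g10) WORD #29 «p13 → (e) `stub_U2H_typeTwoRow_wild`»; LH4-p12 (g0) census v2 (b′-2) «dictionary», p13 first seat), 2026-09-03.
-/
import Literature.NumberTheory.Automorphic.SLTwoTreeEllipticFixedBallTorusForm             -- ★ p855257 (this seat): torus-form vertex balls; brings ★ `exists_conj_eq_of_trace_eq_of_det_eq`, the inert ∕ Eisenstein helpers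
import HarnessLib

/-!
# The torus NORMAL FORM of an elliptic element of `GL₂(F)` for a GENERAL quadratic datum `τ² = uτ + v` (any residue characteristic): `h g h⁻¹ = x·(1, bv; b, 1 + bu)`,
# `x = (tr g − zu)∕2`, `b = 2z∕(tr g − zu)`, where `tr²g − 4 det g = (u² + 4v)·z²`; deep ⟹ `b ∈ 𝒪`; `|det (1, bv; b, 1 + bu)| = 1` for an inert or Eisenstein datum
# (Labesse–Langlands 1979 §2; Serre, *Trees* II §1.3)

Topic `NumberTheory/Automorphic`; namespace `Literature.NumberTheory.Automorphic.HermitianLatticeTree`.  THEOREMS ONLY (no definition, no instance, no notation, no named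
fact, no `sorry`); kernel lane `--supports stmt-HodgeConjecture-24833`.  Cell `pub/hodgecm-mathlib` (D-0151), crux H413; Track A «(D-RAM) FOUR-FRAME», unit U2H (ii-H):
the BINDER-SUPPLIER of ★ p855257 (`SLTwoTreeEllipticFixedBallTorusForm`) and ★ p855511 (`F0P3cDyRamHSideTypeTwoTorusForm`) — their torus datum
`(hc, hconj, hγ₁, ha, hb, hγ₁det)` — from the INVARIANTS `(tr g, det g)` of the descent representative, for a general datum `(u, v)` (the `u = 0`, `τ² = ε₀` case is ★
`exists_conj_eq_smul_regRepOne`, which at a dyadic place does not reach the unramified quadratic extension `τ² = τ + c`).  The hypothesis `(2 : F) ≠ 0` below is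
«characteristic `≠ 2`» (true for every `L⁺_v`), NOT the tameness `|2| = 1`.  HONEST LABEL: HC_CM is proved only modulo the 7 printed citations (2 remaining named inputs:
hLiu418 = stmt-HodgeConjecture-24832, h413 = stmt-HodgeConjecture-24833) until rung 0 closes; nothing printed is asserted here — local algebra.

THE MATHEMATICS.  Let `g ∈ GL₂(F)` have trace `t`, determinant `d`, and let `t² − 4d = (u² + 4v)·z²` with `z ≠ 0`, `u² + 4v ≠ 0` (the eigenvalues of `g` are `x ± zτ'`-shaped:
`g` acts like multiplication by `λ = x + zτ` on `F(τ) = F ⊕ Fτ`, `τ² = uτ + v`, `x = (t − zu)∕2`).  Both `g` and `x·(1, bv; b, 1 + bu)` (`b = z∕x`) are non-scalar with trace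
`2x + zu = t` and determinant `x² + xzu − z²v = (t² − (u² + 4v)z²)∕4 = d`, so they are conjugate (★ `exists_conj_eq_of_trace_eq_of_det_eq`) — §1.  DEPTH: if
`|t² − 4d| < |u² + 4v|·|t|²` (the eigenvalue ratio is close to `1`) and `u ∈ 𝒪`, then `|2z| ≤ |t − zu|`, i.e. `b ∈ 𝒪` and `x ≠ 0` (were `|z| > |x|`, the ultrametric inequality
would give `|t| = |2x + zu| ≤ |z|`, hence `|t² − 4d| ≥ |u² + 4v|·|t|²`) — §2.  UNIT: for `b ∈ 𝒪`, `det (1, bv; b, 1 + bu) = 1 + bu − b²v` is a unit when `(u, v)` is INERT (the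
norm form `c² + ceu − e²v` is anisotropic mod `𝔭`: apply it to `(c, e) = (1, b)`) or EISENSTEIN (`|bu| < 1`, `|b²v| < 1`) — §2.  §3 packages the six binders of ★ p855257.

* §1 `trace_smul_torusFormOne`, `det_torusFormOne`, **`exists_conj_eq_smul_torusFormOne`** (N1).
* §2 **`valuation_two_mul_le_valuation_sub_of_deep`** (N2), **`valuation_det_torusFormOne_eq_one_of_inert`**, **`valuation_det_torusFormOne_eq_one_of_eisenstein`** (N3).
* §3 **`exists_torusForm_binders_of_inert_of_deep`**, **`exists_torusForm_binders_of_eisenstein_of_deep`** (everything ★ p855257 ∕ ★ p855511 bind, except the census depth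
  `n` with `|b| = |ϖ|ⁿ`, which is ★ `exists_valuation_eq_pow` once `b ≠ 0`).

## References
* [LabesseLanglands1979] J.-P. Labesse, R. P. Langlands, *L-indistinguishability for SL(2)*, Canad. J. Math. 31 (1979), §2 pp. 7–8 (the quadratic tori `T = K^×` of `GL₂`,
  regular representation `x + zτ ↦ (x, zv; z, x + zu)`).
* [Serre1980Trees] J.-P. Serre, *Trees* (1980), Ch. II §1.3 (conjugacy in `GL₂` by trace and determinant; action on the tree).
* [Serre1979] J.-P. Serre, *Local Fields*, GTM 67 (1979), Ch. I §6 (Eisenstein equations), Ch. III §5 (unramified extensions `τ² = uτ + v`).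
-/

set_option autoImplicit false

noncomputable section

open scoped ValuativeRel Matrix MatrixGroups
open Matrix ValuativeRel

namespace Literature.NumberTheory.Automorphic.HermitianLatticeTree

open Literature.NumberTheory.Automorphic Literature.NumberTheory.LocalFields

/-! ## §1 Conjugation to the torus form `x·(1, bv; b, 1 + bu)` (any field of characteristic `≠ 2`) -/

section Algebra

variable {F : Type*} [Field F]

/-- `tr (x·(1, bv; b, 1 + bu)) = x·(2 + bu)`. [cite: LabesseLanglands1979, §2 p. 7] -/
theorem trace_smul_torusFormOne (x b u v : F) : (x • (!![1, b * v; b, 1 + b * u] : Matrix (Fin 2) (Fin 2) F)).trace = x * (2 + b * u) := by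
  rw [Matrix.trace_smul, Matrix.trace_fin_two_of, smul_eq_mul]; ring

/-- `det (1, bv; b, 1 + bu) = 1 + bu − b²v` (the norm of `1 + bτ`, `τ² = uτ + v`). [cite: LabesseLanglands1979, §2 p. 7] -/
theorem det_torusFormOne (b u v : F) : (!![1, b * v; b, 1 + b * u] : Matrix (Fin 2) (Fin 2) F).det = 1 + b * u - b ^ 2 * v := by
  rw [Matrix.det_fin_two_of]; ring

/-- `det (x·(1, bv; b, 1 + bu)) = x²·(1 + bu − b²v)`. [cite: LabesseLanglands1979, §2 p. 7] -/
theorem det_smul_torusFormOne (x b u v : F) :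
    (x • (!![1, b * v; b, 1 + b * u] : Matrix (Fin 2) (Fin 2) F)).det = x ^ 2 * (1 + b * u - b ^ 2 * v) := by
  rw [Matrix.det_smul, det_torusFormOne, Fintype.card_fin]

/-- **CONJUGATION TO THE TORUS FORM, GENERAL DATUM (N1).**  If `g ∈ GL₂(F)` (`char F ≠ 2`) has `tr g = t`, `det g = d` and `t² − 4d = (u² + 4v)·z²` with `z ≠ 0`,
`u² + 4v ≠ 0` and `t − zu ≠ 0`, then for `x = (t − zu)∕2` and `b = 2z∕(t − zu)` there are `γ₁ h ∈ GL₂(F)` with `↑γ₁ = (1, bv; b, 1 + bu)` and **`↑(h g h⁻¹) = x·↑γ₁`** — the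
regular representation of `λ = x + zτ = x(1 + bτ)` on `F ⊕ Fτ`, `τ² = uτ + v`: both sides are non-scalar with trace `t` and determinant `d`. [cite: LabesseLanglands1979, §2 p. 8]
[cite: Serre1980Trees, Ch. II §1.3] -/
theorem exists_conj_eq_smul_torusFormOne (h2 : (2 : F) ≠ 0) {g : GL (Fin 2) F} {t d u v z : F}
    (htr : (g : Matrix (Fin 2) (Fin 2) F).trace = t) (hdet : (g : Matrix (Fin 2) (Fin 2) F).det = d) (hz : z ≠ 0) (hdisc : u ^ 2 + 4 * v ≠ 0)
    (hD : t ^ 2 - 4 * d = (u ^ 2 + 4 * v) * z ^ 2) (hx : t - z * u ≠ 0) :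
    ∃ (γ₁ h : GL (Fin 2) F), (γ₁ : Matrix (Fin 2) (Fin 2) F) = !![1, (2 * z / (t - z * u)) * v; 2 * z / (t - z * u), 1 + (2 * z / (t - z * u)) * u] ∧
      ((h * g * h⁻¹ : GL (Fin 2) F) : Matrix (Fin 2) (Fin 2) F) = ((t - z * u) / 2) • (γ₁ : Matrix (Fin 2) (Fin 2) F) := by
  -- trace and determinant of the torus form
  have htr' : (((t - z * u) / 2) • (!![1, (2 * z / (t - z * u)) * v; 2 * z / (t - z * u), 1 + (2 * z / (t - z * u)) * u] : Matrix (Fin 2) (Fin 2) F)).trace = t := by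
    rw [trace_smul_torusFormOne]; field_simp; ring
  have hdet' : (((t - z * u) / 2) • (!![1, (2 * z / (t - z * u)) * v; 2 * z / (t - z * u), 1 + (2 * z / (t - z * u)) * u] : Matrix (Fin 2) (Fin 2) F)).det = d := by
    have h4 : (4 : F) ≠ 0 := by rw [show (4 : F) = 2 * 2 by norm_num]; exact mul_ne_zero h2 h2
    have hd : d = (t ^ 2 - (u ^ 2 + 4 * v) * z ^ 2) / 4 := by rw [← hD]; field_simp; ring
    rw [det_smul_torusFormOne, hd]; field_simp; ring
  have hd0 : d ≠ 0 := by rw [← hdet]; exact (g.isUnit.map Matrix.detMonoidHom).ne_zero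
  have hdet1 : (!![1, (2 * z / (t - z * u)) * v; 2 * z / (t - z * u), 1 + (2 * z / (t - z * u)) * u] : Matrix (Fin 2) (Fin 2) F).det ≠ 0 := by
    intro h0
    rw [Matrix.det_smul, h0, mul_zero] at hdet'
    exact hd0 hdet'.symm
  set γ₁ : GL (Fin 2) F := Matrix.GeneralLinearGroup.mk'' _ (isUnit_iff_ne_zero.2 hdet1) with hγ₁
  have hγ₁coe : (γ₁ : Matrix (Fin 2) (Fin 2) F) = !![1, (2 * z / (t - z * u)) * v; 2 * z / (t - z * u), 1 + (2 * z / (t - z * u)) * u] := rfl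
  have hdetγ : (((t - z * u) / 2) • (γ₁ : Matrix (Fin 2) (Fin 2) F)).det ≠ 0 := by rw [hγ₁coe, hdet']; exact hd0
  set γ : GL (Fin 2) F := Matrix.GeneralLinearGroup.mk'' _ (isUnit_iff_ne_zero.2 hdetγ) with hγ
  have hγcoe : (γ : Matrix (Fin 2) (Fin 2) F) = ((t - z * u) / 2) • (γ₁ : Matrix (Fin 2) (Fin 2) F) := rfl
  -- neither `g` nor `γ` is scalar
  have hγns : ¬ ∃ c : F, (γ : Matrix (Fin 2) (Fin 2) F) = c • (1 : Matrix (Fin 2) (Fin 2) F) := by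
    rintro ⟨c, hc⟩
    have h10 := congrArg (fun M : Matrix (Fin 2) (Fin 2) F => M 1 0) hc
    simp only [hγcoe, hγ₁coe, Matrix.smul_apply, Matrix.of_apply, Matrix.cons_val', Matrix.cons_val_zero, Matrix.cons_val_one, Matrix.cons_val_fin_one,
      smul_eq_mul, Matrix.one_apply_ne (show (1 : Fin 2) ≠ 0 by decide), mul_zero] at h10
    have : (t - z * u) / 2 * (2 * z / (t - z * u)) = z := by field_simp
    rw [this] at h10
    exact hz h10
  have hgns : ¬ ∃ c : F, (g : Matrix (Fin 2) (Fin 2) F) = c • (1 : Matrix (Fin 2) (Fin 2) F) := by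
    rintro ⟨c, hc⟩
    have htc : t = 2 * c := by rw [← htr, hc, Matrix.trace_smul, Matrix.trace_one, Fintype.card_fin]; simp; ring
    have hdc : d = c ^ 2 := by rw [← hdet, hc, Matrix.det_smul, Matrix.det_one, Fintype.card_fin, mul_one]
    have : (u ^ 2 + 4 * v) * z ^ 2 = 0 := by rw [← hD, htc, hdc]; ring
    rcases mul_eq_zero.1 this with h | h
    · exact hdisc h
    · exact hz (pow_eq_zero_iff two_ne_zero |>.1 h)
  obtain ⟨h, hh⟩ := exists_conj_eq_of_trace_eq_of_det_eq g γ hgns hγns (by rw [htr, hγcoe, hγ₁coe, htr']) (by rw [hdet, hγcoe, hγ₁coe, hdet'])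
  exact ⟨γ₁, h, hγ₁coe, by rw [hh, hγcoe]⟩

end Algebra

/-! ## §2 Depth gives `b ∈ 𝒪`; the torus form has unit determinant for an inert or Eisenstein datum -/

section Valuation

variable {F : Type*} [Field F] [ValuativeRel F]

/-- **DEEP ⟹ VERTEX TYPE (N2)**: if `u ∈ 𝒪`, `t² − 4d = (u² + 4v)·z²` and `|t² − 4d| < |u² + 4v|·|t|²` (the eigenvalue ratio of `g` is close to `1`), then `|2z| ≤ |t − zu|`
— so `x = (t − zu)∕2 ≠ 0` and `b = 2z∕(t − zu) ∈ 𝒪`.  (Were `|t − zu| < |2z|`, then `|t| ≤ max(|t − zu|, |zu|) ≤ |z|` ultrametrically, whence `|t² − 4d| = |u² + 4v|·|z|² ≥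
|u² + 4v|·|t|²`.) [cite: LabesseLanglands1979, §2 p. 8] [cite: Serre1980Trees, Ch. II §1.3] -/
theorem valuation_two_mul_le_valuation_sub_of_deep {t d u v z : F} (hu : u ∈ 𝒪[F]) (hD : t ^ 2 - 4 * d = (u ^ 2 + 4 * v) * z ^ 2)
    (hdeep : valuation F (t ^ 2 - 4 * d) < valuation F (u ^ 2 + 4 * v) * valuation F t ^ 2) :
    valuation F (2 * z) ≤ valuation F (t - z * u) := by
  by_contra hlt
  rw [not_le] at hlt
  -- `|2z| ≤ |z|` and `|zu| ≤ |z|`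
  have h2 : valuation F (2 : F) ≤ 1 := by
    have : valuation F (2 : F) = valuation F ((1 : F) + 1) := by norm_num
    rw [this]; exact (Valuation.map_add _ _ _).trans (by rw [Valuation.map_one, max_self])
  have h2z : valuation F (2 * z) ≤ valuation F z := by
    rw [Valuation.map_mul]; exact mul_le_of_le_one_left' h2
  have hzu : valuation F (z * u) ≤ valuation F z := by
    rw [Valuation.map_mul]; exact mul_le_of_le_one_right' ((Valuation.mem_integer_iff _ _).1 hu)
  -- hence `|t| ≤ |z|`
  have ht : valuation F t ≤ valuation F z := by
    have : t = (t - z * u) + z * u := by ring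
    rw [this]
    refine (Valuation.map_add _ _ _).trans (max_le (le_trans hlt.le h2z) hzu)
  -- and `|u² + 4v|·|t|² ≤ |u² + 4v|·|z|² = |t² − 4d|`
  have hle : valuation F (u ^ 2 + 4 * v) * valuation F t ^ 2 ≤ valuation F (t ^ 2 - 4 * d) := by
    rw [hD, Valuation.map_mul, Valuation.map_pow]
    exact mul_le_mul' le_rfl (pow_le_pow_left' ht 2)
  exact absurd (lt_of_lt_of_le hdeep hle) (lt_irrefl _)

/-- **UNIT DETERMINANT, INERT DATUM (N3)**: if the norm form `c² + ceu − e²v` is anisotropic modulo `𝔭` (`hanis`) and `b ∈ 𝒪`, then `|det (1, bv; b, 1 + bu)| = |1 + bu − b²v| = 1`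
(apply `hanis` to `(c, e) = (1, b)`: `|1| < 1` is absurd). [cite: LabesseLanglands1979, §2 p. 8] [cite: Serre1979, Ch. III §5] -/
theorem valuation_det_torusFormOne_eq_one_of_inert {u v : F} (hu : u ∈ 𝒪[F]) (hv : v ∈ 𝒪[F])
    (hanis : ∀ c e : F, c ∈ 𝒪[F] → e ∈ 𝒪[F] → valuation F (c ^ 2 + c * e * u - e ^ 2 * v) < 1 → valuation F c < 1 ∧ valuation F e < 1)
    {b : F} (hb : b ∈ 𝒪[F]) : valuation F (!![1, b * v; b, 1 + b * u] : Matrix (Fin 2) (Fin 2) F).det = 1 := by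
  rw [det_torusFormOne]
  have hint : (1 + b * u - b ^ 2 * v) ∈ 𝒪[F] := by
    have h1 : (1 : F) ∈ 𝒪[F] := Subring.one_mem _
    exact Subring.sub_mem _ (Subring.add_mem _ h1 (Subring.mul_mem _ hb hu)) (Subring.mul_mem _ (Subring.pow_mem _ hb 2) hv)
  rcases ((Valuation.mem_integer_iff _ _).1 hint).lt_or_eq with hlt | heq
  · exfalso
    have heq' : (1 : F) ^ 2 + 1 * b * u - b ^ 2 * v = 1 + b * u - b ^ 2 * v := by ring
    have h := hanis 1 b (Subring.one_mem _) hb (by rw [heq']; exact hlt)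
    rw [Valuation.map_one] at h
    exact lt_irrefl _ h.1
  · exact heq

/-- **UNIT DETERMINANT, EISENSTEIN DATUM (N3)**: if `|u| < 1`, `|v| < 1` and `b ∈ 𝒪`, then `|1 + bu − b²v| = 1` (`|bu| < 1`, `|b²v| < 1`, ultrametric).
[cite: LabesseLanglands1979, §2 p. 8] [cite: Serre1979, Ch. I §6] -/
theorem valuation_det_torusFormOne_eq_one_of_eisenstein {u v : F} (hu1 : valuation F u < 1) (hv1 : valuation F v < 1)
    {b : F} (hb : b ∈ 𝒪[F]) : valuation F (!![1, b * v; b, 1 + b * u] : Matrix (Fin 2) (Fin 2) F).det = 1 := by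
  rw [det_torusFormOne]
  have hb1 : valuation F b ≤ 1 := (Valuation.mem_integer_iff _ _).1 hb
  have hbu : valuation F (b * u) < 1 := by
    rw [Valuation.map_mul]; exact lt_of_le_of_lt (mul_le_of_le_one_left' hb1) hu1
  have hbv : valuation F (b ^ 2 * v) < 1 := by
    rw [Valuation.map_mul, Valuation.map_pow]; exact lt_of_le_of_lt (mul_le_of_le_one_left' (pow_le_one' hb1 2)) hv1
  have hsmall : valuation F (b * u - b ^ 2 * v) < 1 := lt_of_le_of_lt (Valuation.map_sub _ _ _) (max_lt hbu hbv)
  have : (1 : F) + b * u - b ^ 2 * v = 1 + (b * u - b ^ 2 * v) := by ring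
  rw [this, Valuation.map_one_add_of_lt _ hsmall]

end Valuation

/-! ## §3 The binder package of ★ p855257 ∕ ★ p855511 from `(tr g, det g)` and a datum -/

section Package

variable {F : Type*} [Field F] [ValuativeRel F]

/-- **THE TORUS-FORM BINDERS OF A DEEP ELLIPTIC ELEMENT, INERT DATUM.**  For `g ∈ GL₂(F)` (`char F ≠ 2`) with `tr g = t`, `det g = d`, `t² − 4d = (u² + 4v)·z²`, `z ≠ 0`,
`u² + 4v ≠ 0`, an INERT datum `(u, v)` and DEPTH `|t² − 4d| < |u² + 4v|·|t|²`: there are `γ₁ h ∈ GL₂(F)` and `c b ∈ F` with `c ≠ 0`, `↑(h g h⁻¹) = c·↑γ₁`, `↑γ₁ = (1, bv; b, 1 + bu)`,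
`b ∈ 𝒪`, `|det γ₁| = 1`, and `b·(t − zu) = 2z` (so `|b| = |2z|∕|t − zu|`; the census depth `n` with `|b| = |ϖ|ⁿ` is ★ `exists_valuation_eq_pow`) — exactly the binders
`hc hconj hγ₁ (ha := one_mem) hb hγ₁det` of ★ `ncard_setOf_glVertexAct_eq_self_of_inert_torusForm` with `a = 1`. [cite: LabesseLanglands1979, §2 p. 8] [cite: Serre1980Trees, Ch. II §1.3] -/
theorem exists_torusForm_binders_of_inert_of_deep (h2 : (2 : F) ≠ 0) {g : GL (Fin 2) F} {t d u v z : F}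
    (htr : (g : Matrix (Fin 2) (Fin 2) F).trace = t) (hdet : (g : Matrix (Fin 2) (Fin 2) F).det = d) (hz : z ≠ 0) (hdisc : u ^ 2 + 4 * v ≠ 0)
    (hD : t ^ 2 - 4 * d = (u ^ 2 + 4 * v) * z ^ 2) (hu : u ∈ 𝒪[F]) (hv : v ∈ 𝒪[F])
    (hanis : ∀ c e : F, c ∈ 𝒪[F] → e ∈ 𝒪[F] → valuation F (c ^ 2 + c * e * u - e ^ 2 * v) < 1 → valuation F c < 1 ∧ valuation F e < 1)
    (hdeep : valuation F (t ^ 2 - 4 * d) < valuation F (u ^ 2 + 4 * v) * valuation F t ^ 2) :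
    ∃ (γ₁ h : GL (Fin 2) F) (c b : F), c ≠ 0 ∧ ((h * g * h⁻¹ : GL (Fin 2) F) : Matrix (Fin 2) (Fin 2) F) = c • (γ₁ : Matrix (Fin 2) (Fin 2) F) ∧
      (γ₁ : Matrix (Fin 2) (Fin 2) F) = !![1, b * v; b, 1 + b * u] ∧ b ∈ 𝒪[F] ∧ valuation F (γ₁ : Matrix (Fin 2) (Fin 2) F).det = 1 ∧ b * (t - z * u) = 2 * z := by
  have hle := valuation_two_mul_le_valuation_sub_of_deep (d := d) hu hD hdeep
  have hx : t - z * u ≠ 0 := by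
    intro h0
    rw [h0, Valuation.map_zero, le_zero_iff, Valuation.zero_iff] at hle
    exact hz ((mul_eq_zero.1 hle).resolve_left h2)
  obtain ⟨γ₁, h, hγ₁, hconj⟩ := exists_conj_eq_smul_torusFormOne h2 htr hdet hz hdisc hD hx
  have hb : 2 * z / (t - z * u) ∈ 𝒪[F] := by
    rw [Valuation.mem_integer_iff, Valuation.map_div]
    exact div_le_one_of_le₀ hle zero_le
  refine ⟨γ₁, h, (t - z * u) / 2, 2 * z / (t - z * u), div_ne_zero hx h2, hconj, hγ₁, hb, ?_, by field_simp⟩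
  rw [hγ₁]
  exact valuation_det_torusFormOne_eq_one_of_inert hu hv hanis hb

/-- **THE TORUS-FORM BINDERS OF A DEEP ELLIPTIC ELEMENT, EISENSTEIN DATUM** (`|u| < 1`, `|v| = |ϖ|` for a uniformiser `ϖ`): as in the inert case, with `|det γ₁| = 1` from
`|bu|, |b²v| < 1`. [cite: LabesseLanglands1979, §2 p. 8] [cite: Serre1980Trees, Ch. II §1.3] [cite: Serre1979, Ch. I §6] -/
theorem exists_torusForm_binders_of_eisenstein_of_deep (h2 : (2 : F) ≠ 0) {ϖ : F} (hϖ : IsUniformizingElement ϖ) {g : GL (Fin 2) F} {t d u v z : F}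
    (htr : (g : Matrix (Fin 2) (Fin 2) F).trace = t) (hdet : (g : Matrix (Fin 2) (Fin 2) F).det = d) (hz : z ≠ 0) (hdisc : u ^ 2 + 4 * v ≠ 0)
    (hD : t ^ 2 - 4 * d = (u ^ 2 + 4 * v) * z ^ 2) (hu : u ∈ 𝒪[F]) (hu1 : valuation F u < 1) (hv1 : valuation F v = valuation F ϖ)
    (hdeep : valuation F (t ^ 2 - 4 * d) < valuation F (u ^ 2 + 4 * v) * valuation F t ^ 2) :
    ∃ (γ₁ h : GL (Fin 2) F) (c b : F), c ≠ 0 ∧ ((h * g * h⁻¹ : GL (Fin 2) F) : Matrix (Fin 2) (Fin 2) F) = c • (γ₁ : Matrix (Fin 2) (Fin 2) F) ∧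
      (γ₁ : Matrix (Fin 2) (Fin 2) F) = !![1, b * v; b, 1 + b * u] ∧ b ∈ 𝒪[F] ∧ valuation F (γ₁ : Matrix (Fin 2) (Fin 2) F).det = 1 ∧ b * (t - z * u) = 2 * z := by
  have hle := valuation_two_mul_le_valuation_sub_of_deep (d := d) hu hD hdeep
  have hx : t - z * u ≠ 0 := by
    intro h0
    rw [h0, Valuation.map_zero, le_zero_iff, Valuation.zero_iff] at hle
    exact hz ((mul_eq_zero.1 hle).resolve_left h2)
  obtain ⟨γ₁, h, hγ₁, hconj⟩ := exists_conj_eq_smul_torusFormOne h2 htr hdet hz hdisc hD hx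
  have hb : 2 * z / (t - z * u) ∈ 𝒪[F] := by
    rw [Valuation.mem_integer_iff, Valuation.map_div]
    exact div_le_one_of_le₀ hle zero_le
  refine ⟨γ₁, h, (t - z * u) / 2, 2 * z / (t - z * u), div_ne_zero hx h2, hconj, hγ₁, hb, ?_, by field_simp⟩
  rw [hγ₁]
  exact valuation_det_torusFormOne_eq_one_of_eisenstein hu1 (by rw [hv1]; exact hϖ.valuation_lt_one) hb

end Package

end Literature.NumberTheory.Automorphic.HermitianLatticeTree

end
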